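import Literature.AlgebraicGeometry.Motives.ProjectiveSpaceRingPoints
import Literature.AlgebraicGeometry.Motives.VarietiesProperProofs
import HarnessLib

/-!
# Ring-valued points of projective space: image in `V₊(G)` and rigidity over a domain

Sequel to `Motives/ProjectiveSpaceRingPoints` (the `k`-morphism `Spec S → ℙⁿ_k` with homogeneous
coordinates `v ∈ Sⁿ⁺¹`, `ProjectiveSpace.vecChartPoint`):

* `ProjectiveSpace.range_vecChartPoint_subset_zeroLocus`: if `G(v) = 0` for `G` homogeneous of
  positive degree, `Spec S → ℙⁿ_k` lands in `V₊(G)` — checked on the points `Spec L → Spec S`,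
  `L = Frac(S/𝔭)`, where the field dictionary of `Motives/ProjectiveSpaceFieldPoints` applies;
* **rigidity** (`ProjectiveSpace.vecChartPoint_eq_of_cross_eq`): over a domain `S`, vectors
  `v, w` with all minors `vᵢ wⱼ − vⱼ wᵢ = 0` define the same morphism (they are proportional over
  `Frac S`; a morphism from a reduced scheme to a separated one is determined on a dense subscheme,
  Mathlib `ext_of_isDominant_of_isSeparated`, here the generic point `Spec (Frac S) → Spec S`).
  Görtz–Wedhorn I Prop. 9.19; Hartshorne II Ex. 4.2.

## References

* U. Görtz, T. Wedhorn, *Algebraic Geometry I*, 2nd ed. (2020): Prop. 9.19, (13.8). [GortzWedhorn2020]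
* R. Hartshorne, *Algebraic Geometry* (1977): II Ex. 4.2, II Thm. 7.1. [Hartshorne1977]
-/

noncomputable section

open CategoryTheory AlgebraicGeometry HomogeneousLocalization MvPolynomial

universe u

namespace Literature.AlgebraicGeometry.Motives

namespace ProjectiveSpace

variable {k : Type u} [Field k] {n : ℕ} {S : Type u} [CommRing S] [Algebra k S]

attribute [local instance] MvPolynomial.gradedAlgebra ProjBaseChange.algebraBase

local notation "𝒜" => MvPolynomial.homogeneousSubmodule (Fin (n + 1)) k

/-! ### Vectors with a unit value of a positive-degree form are non-zero -/

/-- A homogeneous polynomial of positive degree vanishes at the zero vector. [folklore] -/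
theorem aeval_zero_of_mem {t : MvPolynomial (Fin (n + 1)) k} {d : ℕ} (ht : t ∈ 𝒜 d) (hd : 0 < d) :
    aeval (0 : Fin (n + 1) → S) t = 0 := by
  rw [aeval_zero]
  have h0 : constantCoeff t = 0 := by
    rw [constantCoeff_eq]
    exact ((mem_homogeneousSubmodule d t).mp ht).coeff_eq_zero (by simpa using hd.ne)
  rw [h0, map_zero]

/-- Over a field, a vector at which a positive-degree form does not vanish is non-zero. [folklore] -/
theorem ne_zero_of_aeval_ne_zero {L : Type u} [Field L] [Algebra k L] {t : MvPolynomial (Fin (n + 1)) k}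
    {d : ℕ} (ht : t ∈ 𝒜 d) (hd : 0 < d) {z : Fin (n + 1) → L} (hz : aeval z t ≠ 0) : z ≠ 0 := by
  rintro rfl
  exact hz (aeval_zero_of_mem ht hd)

/-! ### The points `Spec Frac(S/𝔭) → Spec S` -/

section ResiduePoint

variable (𝔭 : PrimeSpectrum S)

/-- The field `Frac(S/𝔭)` attached to a prime `𝔭` of `S`. [folklore] -/
abbrev residueDomainField : Type u := FractionRing (S ⧸ 𝔭.asIdeal)

variable (k) in
/-- The `k`-algebra map `S → S/𝔭 → Frac(S/𝔭)`. [folklore] -/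
def toResidueDomainField : S →ₐ[k] residueDomainField 𝔭 :=
  (IsScalarTower.toAlgHom k (S ⧸ 𝔭.asIdeal) (residueDomainField 𝔭)).comp (Ideal.Quotient.mkₐ k 𝔭.asIdeal)

/-- The kernel of `S → Frac(S/𝔭)` is `𝔭`. [folklore] -/
theorem toResidueDomainField_eq_zero_iff (a : S) :
    toResidueDomainField k 𝔭 a = 0 ↔ a ∈ 𝔭.asIdeal := by
  change algebraMap (S ⧸ 𝔭.asIdeal) (residueDomainField 𝔭) (Ideal.Quotient.mk 𝔭.asIdeal a) = 0 ↔ _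
  rw [map_eq_zero_iff _ (IsFractionRing.injective (S ⧸ 𝔭.asIdeal) (residueDomainField 𝔭)),
    Ideal.Quotient.eq_zero_iff_mem]

/-- `Spec Frac(S/𝔭) → Spec S` hits exactly `𝔭`. [folklore] -/
theorem specOverOfAlgHom_toResidueDomainField_apply (x : PrimeSpectrum (residueDomainField 𝔭)) :
    (specOverOfAlgHom (toResidueDomainField k 𝔭)).left x = 𝔭 := by
  rw [specOverOfAlgHom_left]
  change PrimeSpectrum.comap (toResidueDomainField k 𝔭).toRingHom x = 𝔭
  ext a
  rw [PrimeSpectrum.comap_asIdeal, Ideal.mem_comap,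
    show x.asIdeal = ⊥ from (Subsingleton.elim x ⊥ : x = (⊥ : PrimeSpectrum _)) ▸ rfl, Ideal.mem_bot]
  exact toResidueDomainField_eq_zero_iff (k := k) 𝔭 a

end ResiduePoint

/-! ### The image lies in `V₊(G)` when `G(v) = 0` -/

section Range

variable {t : MvPolynomial (Fin (n + 1)) k} {d : ℕ}

/-- **If `G(v) = 0` then `Spec S → ℙⁿ_k` with homogeneous coordinates `v` lands in `V₊(G)`** (`G`
homogeneous of positive degree): every point of `Spec S` is the image of `Spec Frac(S/𝔭)`, on which
the morphism is the field point with coordinates `v mod 𝔭` (functoriality), which lies in `V₊(G)` by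
`pt_pointOfVec_mem_zeroLocus_iff`. [folklore] -/
theorem range_vecChartPoint_subset_zeroLocus (ht : t ∈ 𝒜 d) (hd : 0 < d) (v : Fin (n + 1) → S)
    (hv : IsUnit (aeval v t)) {m : ℕ} (hm : 0 < m) {G : MvPolynomial (Fin (n + 1)) k} (hG : G ∈ 𝒜 m)
    (hGv : aeval v G = 0) :
    Set.range (vecChartPoint ht hd v hv).left ⊆
      ProjectiveSpectrum.zeroLocus 𝒜 ({G} : Set (MvPolynomial (Fin (n + 1)) k)) := by
  rintro _ ⟨𝔭, rfl⟩
  let ρ := toResidueDomainField k 𝔭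
  have hρv : IsUnit (aeval (fun j => ρ (v j)) t) := isUnit_aeval_comp ρ hv
  have hz : (fun j => ρ (v j)) ≠ 0 := ne_zero_of_aeval_ne_zero ht hd hρv.ne_zero
  -- `𝔭` is the image of the point of `Spec Frac(S/𝔭)`
  have h𝔭 : (vecChartPoint ht hd v hv).left 𝔭 =
      ((specOverOfAlgHom ρ ≫ vecChartPoint ht hd v hv).left) (IsLocalRing.closedPoint _) := by
    rw [Over.comp_left, Scheme.Hom.comp_apply, specOverOfAlgHom_toResidueDomainField_apply]
  rw [h𝔭, specOverOfAlgHom_comp_vecChartPoint ρ ht hd v hv hρv,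
    vecChartPoint_eq_chartPoint ht hd _ hρv.ne_zero, ← pointOfVec_eq_chartPoint _ hz ht hd]
  refine (pt_pointOfVec_mem_zeroLocus_iff _ hz hm hG).mpr ?_
  have h := DFunLike.congr_fun (MvPolynomial.comp_aeval (f := v) ρ) G
  simp only [AlgHom.coe_comp, Function.comp_apply] at h
  rw [← h, hGv, map_zero]

end Range

/-! ### Rigidity over a domain -/

section Rigidity

variable [IsDomain S] {t t' : MvPolynomial (Fin (n + 1)) k} {d d' : ℕ}

/-- `Spec (Frac S) → Spec S` is dominant for a domain `S`. [folklore] -/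
instance isDominant_specOverOfAlgHom_fractionRing :
    IsDominant (specOverOfAlgHom (IsScalarTower.toAlgHom k S (FractionRing S))).left := by
  rw [specOverOfAlgHom_left, isDominant_iff]
  change DenseRange (PrimeSpectrum.comap (algebraMap S (FractionRing S)))
  rw [PrimeSpectrum.denseRange_comap_iff_ker_le_nilRadical,
    (RingHom.injective_iff_ker_eq_bot _).mp (IsFractionRing.injective S (FractionRing S))]
  exact bot_le

/-- Cross relations over a domain give proportionality over the fraction field. [folklore] -/
theorem exists_smul_of_cross_eq {L : Type u} [Field L] {v w : Fin (n + 1) → L} (hv : v ≠ 0) (hw : w ≠ 0)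
    (h : ∀ i j, v i * w j = v j * w i) : ∃ c : L, c ≠ 0 ∧ w = c • v := by
  obtain ⟨i₀, hi₀⟩ := Function.ne_iff.mp hv
  have hi₀ : v i₀ ≠ 0 := by simpa using hi₀
  refine ⟨w i₀ / v i₀, ?_, ?_⟩
  · intro hc
    rw [div_eq_zero_iff, or_iff_left hi₀] at hc
    apply hw
    funext j
    have := h i₀ j
    rw [hc, mul_zero] at this
    exact (mul_eq_zero.mp this).resolve_left hi₀
  · funext j
    rw [Pi.smul_apply, smul_eq_mul, div_mul_eq_mul_div, eq_div_iff hi₀, mul_comm (w j), h i₀ j,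
      mul_comm]

/-- **Rigidity**: over a domain `S`, two coordinate vectors `v, w` (with unit values of
positive-degree forms `t, t'`) all of whose `2 × 2` minors `vᵢ wⱼ − vⱼ wᵢ` vanish define the same
`k`-morphism `Spec S → ℙⁿ_k`. Görtz–Wedhorn I Prop. 9.19 (reduced-to-separated morphisms agreeing on
a dense subscheme are equal), Hartshorne II Ex. 4.2. [cite: GortzWedhorn2020, Prop. 9.19] -/
theorem vecChartPoint_eq_of_cross_eq (ht : t ∈ 𝒜 d) (hd : 0 < d) (ht' : t' ∈ 𝒜 d') (hd' : 0 < d')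
    (v w : Fin (n + 1) → S) (hv : IsUnit (aeval v t)) (hw : IsUnit (aeval w t'))
    (h : ∀ i j, v i * w j = v j * w i) :
    vecChartPoint ht hd v hv = vecChartPoint ht' hd' w hw := by
  let L := FractionRing S
  let ρ : S →ₐ[k] L := IsScalarTower.toAlgHom k S L
  have hρv : IsUnit (aeval (fun j => ρ (v j)) t) := isUnit_aeval_comp ρ hv
  have hρw : IsUnit (aeval (fun j => ρ (w j)) t') := isUnit_aeval_comp ρ hw
  have hvz : (fun j => ρ (v j)) ≠ 0 := ne_zero_of_aeval_ne_zero ht hd hρv.ne_zero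
  have hwz : (fun j => ρ (w j)) ≠ 0 := ne_zero_of_aeval_ne_zero ht' hd' hρw.ne_zero
  obtain ⟨c, hc, hcw⟩ := exists_smul_of_cross_eq hvz hwz fun i j => by
    change ρ (v i) * ρ (w j) = ρ (v j) * ρ (w i)
    rw [← map_mul, ← map_mul, h i j]
  -- the two morphisms agree on the generic point
  have hgen : specOverOfAlgHom ρ ≫ vecChartPoint ht hd v hv = specOverOfAlgHom ρ ≫ vecChartPoint ht' hd' w hw := by
    rw [specOverOfAlgHom_comp_vecChartPoint ρ ht hd v hv hρv, specOverOfAlgHom_comp_vecChartPoint ρ ht' hd' w hw hρw,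
      vecChartPoint_eq_chartPoint ht hd _ hρv.ne_zero, vecChartPoint_eq_chartPoint ht' hd' _ hρw.ne_zero,
      ← pointOfVec_eq_chartPoint _ hvz ht hd, ← pointOfVec_eq_chartPoint _ hwz ht' hd']
    have hcw' : (fun j => ρ (w j)) = c • fun j => ρ (v j) := hcw
    simp only [hcw']
    exact (pointOfVec_smul _ hvz c hc _).symm
  -- reduced source, separated target: equality follows
  ext : 1
  haveI : IsSeparated (projectiveSpace n k).hom := (isProper_projectiveSpace n k).toIsSeparated
  haveI : IsReduced (specOver k S).left := inferInstanceAs (IsReduced (Spec (CommRingCat.of S)))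
  refine ext_of_isDominant_of_isSeparated (projectiveSpace n k).hom ?_ (specOverOfAlgHom ρ).left ?_
  · rw [Over.w, Over.w]
  · rw [← Over.comp_left, ← Over.comp_left, hgen]

end Rigidity

end ProjectiveSpace

end Literature.AlgebraicGeometry.Motives
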